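import Summits.QuantumAdvantage.QuantumAdvantage.Theses.CubicForrelation

/-!
# `SignedExactHardImpliesTarget` holds — support item `stmt-QuantumAdvantage-13935`
(route `CubicForrelation`, rank 9)

The route decl
`Summit.QuantumAdvantage.QuantumAdvantage.Theses.CubicForrelation.SignedExactHardImpliesTarget` is the
glue `SignedExactCubicForrelationNotPrBPP → SignedCubicForrelationNotPrBPP` from the crux r3 (the signed
EXACT slice of cubic 2-fold Forrelation, YES `Φ = 1` / NO `Φ = −1`, is not in `PromiseBPP'`) to the
thesis X (the signed cubic 2-fold Forrelation problem, YES `Φ ≥ 3/5` / NO `Φ ≤ −3/5`, is not in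
`PromiseBPP'`).

Proof (sub-promise monotonicity): the signed exact yes-set (`IsOverB2 ∧ value = 1 ∧ …`) lies in the
target's yes-set (`IsYes = IsOverB2 ∧ 3/5 ≤ value`, and `3/5 ≤ 1`), the signed exact no-set
(`value = −1`) lies in the target's no-set (`−1 ≤ −3/5`), images under `KForrelationInstance.encode`
are monotone, and textbook promise-`BPP` (`PromiseBPP'`, [Goldreich2006] Def. 1.2) is antitone in the
promise: the same `L' ∈ P` and coin polynomial `p` work on the smaller promise (cf.
`Literature.Computability.Cryptography.mem_PromiseBPP'_of_subset`, inlined here to keep the import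
list to the route file). Hence membership of X's problem in `PromiseBPP'` would give membership of the
exact slice, i.e. the contrapositive of the decl.
-/

set_option linter.dupNamespace false -- D-0017: single-problem summit ⇒ `QuantumAdvantage.QuantumAdvantage` by design

namespace Summit.QuantumAdvantage.QuantumAdvantage.Theorems

open Literature.Computability.QuantumComplexity Literature.Computability.Complexity

/-- **Support `SignedExactHardImpliesTarget` (stmt-QuantumAdvantage-13935) holds**: if the signed
exact slice of cubic 2-fold Forrelation (YES `Φ = 1`, NO `Φ = −1`; `k = 2`, `n` even, both phase
functions of `𝔽₂`-degree `≤ 3`, `B₂`-circuits) is not in `PromiseBPP'`, then neither is the signed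
cubic 2-fold Forrelation problem (YES `Φ ≥ 3/5`, NO `Φ ≤ −3/5`): the exact slice is a sub-promise
(`value = 1 ⇒ IsYes`, `value = −1 ⇒ value ≤ −3/5`) and `PromiseBPP'` is antitone in the promise
(the same `P`-predicate and coin-length polynomial decide the smaller promise). -/
theorem SignedExactHardImpliesTarget_proof :
    Summit.QuantumAdvantage.QuantumAdvantage.Theses.CubicForrelation.SignedExactHardImpliesTarget := by
  unfold Summit.QuantumAdvantage.QuantumAdvantage.Theses.CubicForrelation.SignedExactHardImpliesTarget
    Summit.QuantumAdvantage.QuantumAdvantage.Theses.CubicForrelation.SignedExactCubicForrelationNotPrBPP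
    Summit.QuantumAdvantage.QuantumAdvantage.Theses.CubicForrelation.SignedCubicForrelationNotPrBPP
  intro hSE hS
  apply hSE
  obtain ⟨L', hL', p, hyes, hno⟩ := hS
  refine ⟨L', hL', p, ?_, ?_⟩
  · rintro x ⟨I, ⟨hB2, hval, hrest⟩, rfl⟩
    exact hyes _ ⟨I, ⟨⟨hB2, by rw [hval]; norm_num⟩, hrest⟩, rfl⟩
  · rintro x ⟨I, ⟨hB2, hval, hrest⟩, rfl⟩
    exact hno _ ⟨I, ⟨⟨hB2, by rw [hval]; norm_num⟩, hrest⟩, rfl⟩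

end Summit.QuantumAdvantage.QuantumAdvantage.Theorems
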